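import Summits.ValiantsHypothesis.ValiantsHypothesis.Theorems.KPlusLogSqLawTropicalBSingleGaugeUniversalLemmas

/-!
# Route «KPlusLogSqLaw», crux `TropicalB` (stmt-ValiantsHypothesis-19771) — lemmas for the two-row single-gauge ceiling `4K − 8`

HONEST FRAMING.  Helper `--supports` the crux `Summit.ValiantsHypothesis.ValiantsHypothesis.Theses.KPlusLogSqLaw.TropicalB` (item
stmt-ValiantsHypothesis-19771, route KPlusLogSqLaw, DRAFT; cell `pub-symmetroid`, seat val-sym-trop-p4 g13, 2026-08-28).  Elementary lemmas for
`…TropicalBSingleGaugeTwoRows.lean` (`chain_le_of_universalGauge_twoRows`: a chain of a format-`(2,K)` design certified by ONE affine row gauge has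
`n ≤ 4K − 8`): exponent RANKS `#{l : d l < d c}` and their comparison lemmas, the CROSS COUNTS `#{l : d l − u < d c − w}` of a two-row state
(monotone in the pivot class; sandwiched by ranks when a cell of the other row lies before / after the pivot), the two-point facts about `Fin 2`
and its permutations, telescoping with a uniform drop, the arithmetic of the potential `Ω = (K−2)(4K−5−S−N) + (2K−2−S)`, and the combinatorics
of a CHARGED row exchange (`charged_facts`: old cross counts ≤ new ranks, new cross counts ≥ old ranks + 1, `A + B ≥ 2`, cost `≤ K − 2`, pre-sum
`≤ 2K − 4`).  Nothing here bears on `TropicalB` in its window, `WeakLifting`, the doors, `MatrixDescartes` (stmt-ValiantsHypothesis-18050) or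
VP ≠ VNP.  [this seat; all folklore-level]
-/

set_option linter.dupNamespace false
set_option autoImplicit false

namespace Summit.ValiantsHypothesis.ValiantsHypothesis.Theorems.KPlusLogSqLaw

open Summit.ValiantsHypothesis.ValiantsHypothesis.Theorems.MatrixDescartes.Negative
open scoped BigOperators
open Finset

namespace SingleGauge

namespace TwoRows

variable {K : ℕ}

/-! ## 1. Exponent ranks -/

/-- rank comparison: a class of no larger exponent has no larger rank. -/
theorem rank_mono (d : Fin K → ℕ) {c c' : Fin K} (h : d c ≤ d c') :
    (univ.filter fun l => d l < d c).card ≤ (univ.filter fun l => d l < d c').card :=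
  card_le_card fun l hl => by
    rw [mem_filter] at hl ⊢
    exact ⟨hl.1, lt_of_lt_of_le hl.2 h⟩

/-- a class of strictly larger exponent has strictly larger rank. -/
theorem rank_lt (d : Fin K → ℕ) {c c' : Fin K} (h : d c < d c') :
    (univ.filter fun l => d l < d c).card + 1 ≤ (univ.filter fun l => d l < d c').card := by
  have hsub : insert c (univ.filter fun l => d l < d c) ⊆ (univ.filter fun l => d l < d c') := by
    intro l hl
    rw [mem_insert] at hl
    rw [mem_filter]
    rcases hl with rfl | hl
    · exact ⟨mem_univ _, h⟩
    · rw [mem_filter] at hl; exact ⟨mem_univ _, hl.2.trans h⟩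
  have hnot : c ∉ (univ.filter fun l => d l < d c) := by
    rw [mem_filter]; exact fun h => lt_irrefl _ h.2
  have := card_le_card hsub
  rw [card_insert_of_notMem hnot] at this
  exact this

/-- ranks are `< K`. -/
theorem rank_lt_K (d : Fin K → ℕ) (c : Fin K) : (univ.filter fun l => d l < d c).card + 1 ≤ K := by
  have hss : (univ.filter fun l => d l < d c) ⊂ (univ : Finset (Fin K)) := by
    rw [Finset.ssubset_iff_of_subset (filter_subset _ _)]
    exact ⟨c, mem_univ _, by rw [mem_filter]; exact fun h => lt_irrefl _ h.2⟩
  have := card_lt_card hss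
  rw [card_univ, Fintype.card_fin] at this
  omega

/-- with injective exponents, `#{l : d l ≤ d c} = rank c + 1`. -/
theorem card_le_eq_rank_succ (d : Fin K → ℕ) (hinj : Function.Injective d) (c : Fin K) :
    (univ.filter fun l => d l ≤ d c).card = (univ.filter fun l => d l < d c).card + 1 := by
  have hnot : c ∉ (univ.filter fun l => d l < d c) := by
    rw [mem_filter]; exact fun h => lt_irrefl _ h.2
  rw [← card_insert_of_notMem hnot]
  congr 1
  ext l
  rw [mem_filter, mem_insert, mem_filter]
  constructor
  · intro h
    rcases lt_or_eq_of_le h.2 with hlt | heq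
    · exact Or.inr ⟨mem_univ _, hlt⟩
    · exact Or.inl (hinj heq)
  · intro h
    rcases h with rfl | h
    · exact ⟨mem_univ _, le_rfl⟩
    · exact ⟨mem_univ _, le_of_lt h.2⟩

/-- rank comparison reflects the exponent order (injective exponents). -/
theorem d_le_of_rank_le (d : Fin K → ℕ) {c c' : Fin K}
    (h : (univ.filter fun l => d l < d c).card ≤ (univ.filter fun l => d l < d c').card) : d c ≤ d c' := by
  by_contra hlt
  push Not at hlt
  have := rank_lt d hlt
  omega

/-! ## 2. The cross counts `A`, `B` of a two-row state (gauged slopes `d l − α i`, `α hi < α lo`) -/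

/-- monotonicity of a cross count in the pivot class. -/
theorem cross_mono (d : Fin K → ℕ) (u w : ℚ) {c c' : Fin K} (h : d c ≤ d c') :
    (univ.filter fun l => (d l : ℚ) - u < (d c : ℚ) - w).card ≤ (univ.filter fun l => (d l : ℚ) - u < (d c' : ℚ) - w).card :=
  card_le_card fun l hl => by
    rw [mem_filter] at hl ⊢
    have : (d c : ℚ) ≤ (d c' : ℚ) := by exact_mod_cast h
    exact ⟨hl.1, by linarith [hl.2]⟩

/-- lower bound: if the pivot cell `(w, c)` is after the cell `(u, e)` then every class of exponent `≤ d e` in row `u` is counted: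
`rank e + 1 ≤ #{l : d l − u < d c − w}`. -/
theorem rank_succ_le_cross (d : Fin K → ℕ) (hinj : Function.Injective d) (u w : ℚ) {e c : Fin K}
    (h : (d e : ℚ) - u < (d c : ℚ) - w) :
    (univ.filter fun l => d l < d e).card + 1 ≤ (univ.filter fun l => (d l : ℚ) - u < (d c : ℚ) - w).card := by
  rw [← card_le_eq_rank_succ d hinj e]
  exact card_le_card fun l hl => by
    rw [mem_filter] at hl ⊢
    have : (d l : ℚ) ≤ (d e : ℚ) := by exact_mod_cast hl.2
    exact ⟨hl.1, by linarith⟩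

/-- upper bound: if the cell `(u, e')` is after the pivot cell `(w, c)` then every counted class has exponent `< d e'`:
`#{l : d l − u < d c − w} ≤ rank e'`. -/
theorem cross_le_rank (d : Fin K → ℕ) (u w : ℚ) {e' c : Fin K}
    (h : (d c : ℚ) - w < (d e' : ℚ) - u) :
    (univ.filter fun l => (d l : ℚ) - u < (d c : ℚ) - w).card ≤ (univ.filter fun l => d l < d e').card :=
  card_le_card fun l hl => by
    rw [mem_filter] at hl ⊢
    have h2 : (d l : ℚ) < (d e' : ℚ) := by linarith [hl.2]
    exact ⟨hl.1, by exact_mod_cast h2⟩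

/-! ## 3. Two rows, two columns -/

/-- in `Fin 2` every element is one of two distinct elements. -/
theorem fin_two_eq_or (lo hi : Fin 2) (h : lo ≠ hi) (i : Fin 2) : i = lo ∨ i = hi := by
  fin_cases lo <;> fin_cases hi <;> fin_cases i <;> simp_all

/-- two distinct permutations of `Fin 2` disagree everywhere. -/
theorem perm_two_apply_ne (σ τ : Equiv.Perm (Fin 2)) (h : σ ≠ τ) (j : Fin 2) : σ j ≠ τ j := by
  intro hj
  apply h
  ext i
  rcases fin_two_eq_or j (if j = 0 then 1 else 0) (by fin_cases j <;> simp) i with rfl | rfl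
  · rw [hj]
  · -- the other point: its image is the unique element different from `σ j = τ j`
    have hj' : (if j = 0 then (1 : Fin 2) else 0) ≠ j := by fin_cases j <;> simp
    have h1 : σ (if j = 0 then 1 else 0) ≠ σ j := fun e => hj' (σ.injective e)
    have h2 : τ (if j = 0 then 1 else 0) ≠ τ j := fun e => hj' (τ.injective e)
    rw [hj] at h1
    rcases fin_two_eq_or (τ j) (σ (if j = 0 then 1 else 0)) (Ne.symm h1) (τ (if j = 0 then 1 else 0)) with e | e
    · exact absurd e h2
    · exact congrArg Fin.val e.symm

/-- telescoping with a uniform drop `D`: `Φ last + n·D ≤ Φ 0`. -/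
theorem potential_telescope {n : ℕ} (Φ : Fin (n + 1) → ℤ) (D : ℤ) (hstep : ∀ k : Fin n, Φ k.succ + D ≤ Φ k.castSucc) :
    Φ (Fin.last n) + (n : ℤ) * D ≤ Φ 0 := by
  have htel : ∀ k : Fin (n + 1), Φ k + (k : ℤ) * D ≤ Φ 0 := by
    intro k
    induction k using Fin.induction with
    | zero => simp
    | succ k ih =>
      have := hstep k
      have hv : ((k.succ : Fin (n + 1)) : ℤ) = ((k.castSucc : Fin (n + 1)) : ℤ) + 1 := by simp [Fin.val_succ]
      rw [hv, add_mul, one_mul]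
      have hc : ((k.castSucc : Fin (n + 1)) : ℤ) = ((k : Fin n) : ℤ) := by simp
      rw [hc] at ih ⊢
      linarith
  have hlast := htel (Fin.last n)
  have hl : ((Fin.last n : Fin (n + 1)) : ℤ) = n := by simp
  rw [hl] at hlast
  exact hlast

/-! ## 4. Arithmetic of the potential `Ω = (K−2)·(4K−5−S−N) + (2K−2−S)` -/

/-- a non-charged step: `S` rises, `N` does not fall ⇒ `Ω` falls by `≥ K − 1`. -/
theorem arith_step_nc (K : ℕ) (hK : 4 ≤ K) (Sa Sb Na Nb : ℤ) (hS : Sa + 1 ≤ Sb) (hN : Na ≤ Nb) :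
    ((K : ℤ) - 2) * (4 * K - 5 - Sb - Nb) + (2 * K - 2 - Sb) + ((K : ℤ) - 1) ≤
      ((K : ℤ) - 2) * (4 * K - 5 - Sa - Na) + (2 * K - 2 - Sa) := by
  have hK4 : (4 : ℤ) ≤ (K : ℤ) := by exact_mod_cast hK
  have hK2 : (0 : ℤ) ≤ (K : ℤ) - 2 := by linarith
  have hx : (0 : ℤ) ≤ (Sb + Nb) - (Sa + Na) - 1 := by linarith
  nlinarith [mul_nonneg hK2 hx]

/-- a charged step: `S + N` rises by `≥ 2` and `S` falls by `≤ K − 3` ⇒ `Ω` falls by `≥ K − 1`. -/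
theorem arith_step_ch (K : ℕ) (hK : 4 ≤ K) (Sa Sb Na Nb : ℤ) (h1 : Sa + Na + 2 ≤ Sb + Nb) (h2 : Sa + 3 ≤ Sb + K) :
    ((K : ℤ) - 2) * (4 * K - 5 - Sb - Nb) + (2 * K - 2 - Sb) + ((K : ℤ) - 1) ≤
      ((K : ℤ) - 2) * (4 * K - 5 - Sa - Na) + (2 * K - 2 - Sa) := by
  have hK4 : (4 : ℤ) ≤ (K : ℤ) := by exact_mod_cast hK
  have hK2 : (0 : ℤ) ≤ (K : ℤ) - 2 := by linarith
  have hx : (0 : ℤ) ≤ (Sb + Nb) - (Sa + Na) - 2 := by linarith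
  nlinarith [mul_nonneg hK2 hx]

/-- bounds of `Ω`: at most `(K−2)(4K−5) + 2K − 2`, at least `K − 2`. -/
theorem arith_bounds (K : ℕ) (hK : 4 ≤ K) (S N : ℤ) (hS0 : 0 ≤ S) (hS : S ≤ 2 * K - 2) (hN0 : 0 ≤ N) (hN : N ≤ 2 * K - 4) :
    ((K : ℤ) - 2) * (4 * K - 5 - S - N) + (2 * K - 2 - S) ≤ ((K : ℤ) - 2) * (4 * K - 5) + (2 * K - 2) ∧
    (K : ℤ) - 2 ≤ ((K : ℤ) - 2) * (4 * K - 5 - S - N) + (2 * K - 2 - S) := by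
  have hK4 : (4 : ℤ) ≤ (K : ℤ) := by exact_mod_cast hK
  have hK2 : (0 : ℤ) ≤ (K : ℤ) - 2 := by linarith
  constructor
  · nlinarith [mul_nonneg hK2 (by linarith : (0:ℤ) ≤ S + N)]
  · nlinarith [mul_nonneg hK2 (by linarith : (0:ℤ) ≤ 4 * K - 5 - S - N - 1)]

/-- the final count: `n·(K−1) ≤ (K−2)(4K−5) + 2K−2 − (K−2)` forces `n ≤ 4K − 8` (`K ≥ 4`). -/
theorem arith_final (K n : ℕ) (hK : 4 ≤ K)
    (h : (n : ℤ) * ((K : ℤ) - 1) ≤ ((K : ℤ) - 2) * (4 * K - 5) + (2 * K - 2) - ((K : ℤ) - 2)) : (n : ℤ) + 8 ≤ 4 * K := by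
  have hK4 : (4 : ℤ) ≤ K := by exact_mod_cast hK
  by_contra hcon
  push Not at hcon
  have h7 : 4 * (K : ℤ) - 7 ≤ n := by linarith
  have hK1 : (0 : ℤ) ≤ (K : ℤ) - 1 := by linarith
  have := mul_le_mul_of_nonneg_right h7 hK1
  nlinarith

/-! ## 5. The combinatorics of a CHARGED row exchange (two rows `lo`, `hi` with `α hi = w < u = α lo`) -/

/-- Facts about a charged row exchange.  Classes: `calo`, `cahi` before, `cblo`, `cbhi` after; `X1`, `X2` = the two columns move forward in
the track; `hch` = some rank drops.  Conclusions: the old cross counts are below the new ranks, the new cross counts remember the old ranks,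
`A + B ≥ 2`, the cost is `≤ K − 2`, and the pre-sum is `≤ 2K − 4`. -/
theorem charged_facts (d : Fin K → ℕ) (hdinj : Function.Injective d) (u w : ℚ) (huw : w < u)
    (hne : ∀ l l' : Fin K, (d l : ℚ) - u ≠ (d l' : ℚ) - w)
    (calo cahi cblo cbhi : Fin K)
    (X1 : (d calo : ℚ) - u < (d cbhi : ℚ) - w) (X2 : (d cahi : ℚ) - w < (d cblo : ℚ) - u)
    (hch : (univ.filter fun l => d l < d cblo).card < (univ.filter fun l => d l < d calo).card ∨ (univ.filter fun l => d l < d cbhi).card < (univ.filter fun l => d l < d cahi).card) :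
    (univ.filter fun l => (d l : ℚ) - u < (d cahi : ℚ) - w).card ≤ (univ.filter fun l => d l < d cblo).card ∧
    (univ.filter fun l => (d l : ℚ) - w < (d calo : ℚ) - u).card ≤ (univ.filter fun l => d l < d cbhi).card ∧
    (univ.filter fun l => d l < d calo).card + 1 ≤ (univ.filter fun l => (d l : ℚ) - u < (d cbhi : ℚ) - w).card ∧
    (univ.filter fun l => d l < d cahi).card + 1 ≤ (univ.filter fun l => (d l : ℚ) - w < (d cblo : ℚ) - u).card ∧
    2 ≤ (univ.filter fun l => (d l : ℚ) - u < (d cahi : ℚ) - w).card + (univ.filter fun l => (d l : ℚ) - w < (d calo : ℚ) - u).card ∧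
    (univ.filter fun l => d l < d calo).card + (univ.filter fun l => d l < d cahi).card + 3 ≤ (univ.filter fun l => d l < d cblo).card + (univ.filter fun l => d l < d cbhi).card + K ∧
    (univ.filter fun l => d l < d calo).card + (univ.filter fun l => d l < d cahi).card + 4 ≤ 2 * K := by
  have E1 : (univ.filter fun l => (d l : ℚ) - u < (d cahi : ℚ) - w).card ≤ (univ.filter fun l => d l < d cblo).card := cross_le_rank d u w X2
  have E2 : (univ.filter fun l => (d l : ℚ) - w < (d calo : ℚ) - u).card ≤ (univ.filter fun l => d l < d cbhi).card := cross_le_rank d w u X1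
  have E3 : (univ.filter fun l => d l < d calo).card + 1 ≤ (univ.filter fun l => (d l : ℚ) - u < (d cbhi : ℚ) - w).card := rank_succ_le_cross d hdinj u w X1
  have E4 : (univ.filter fun l => d l < d cahi).card + 1 ≤ (univ.filter fun l => (d l : ℚ) - w < (d cblo : ℚ) - u).card := rank_succ_le_cross d hdinj w u X2
  have A1 : (univ.filter fun l => d l < d cahi).card + 1 ≤ (univ.filter fun l => (d l : ℚ) - u < (d cahi : ℚ) - w).card := rank_succ_le_cross d hdinj u w (by linarith)
  have E5 : (univ.filter fun l => d l < d cahi).card + 1 ≤ (univ.filter fun l => d l < d cblo).card := by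
    apply rank_lt d
    have : ((d cahi : ℕ) : ℚ) < (d cblo : ℚ) := by linarith
    exact_mod_cast this
  have R1 : (univ.filter fun l => d l < d cblo).card + 1 ≤ K := rank_lt_K d _
  have R2 : (univ.filter fun l => d l < d calo).card + 1 ≤ K := rank_lt_K d _
  have hdich : ((d calo : ℚ) - u < (d cahi : ℚ) - w) ∨ ((d cahi : ℚ) - w < (d calo : ℚ) - u) := by
    rcases lt_trichotomy ((d calo : ℚ) - u) ((d cahi : ℚ) - w) with h | h | h
    · exact Or.inl h
    · exact absurd h (hne _ _)
    · exact Or.inr h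
  -- `A + B ≥ 2`
  have hAB : 2 ≤ (univ.filter fun l => (d l : ℚ) - u < (d cahi : ℚ) - w).card + (univ.filter fun l => (d l : ℚ) - w < (d calo : ℚ) - u).card := by
    by_contra hlt
    push Not at hlt
    have hB0 : (univ.filter fun l => (d l : ℚ) - w < (d calo : ℚ) - u).card = 0 := by omega
    have hnot : ¬ ((d cahi : ℚ) - w < (d calo : ℚ) - u) := by
      intro h
      have : 0 < (univ.filter fun l => (d l : ℚ) - w < (d calo : ℚ) - u).card := card_pos.mpr ⟨cahi, by rw [mem_filter]; exact ⟨mem_univ _, h⟩⟩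
      omega
    have A2 : (univ.filter fun l => d l < d calo).card + 1 ≤ (univ.filter fun l => (d l : ℚ) - u < (d cahi : ℚ) - w).card := rank_succ_le_cross d hdinj u w (hdich.resolve_right hnot)
    omega
  refine ⟨E1, E2, E3, E4, hAB, ?_, ?_⟩
  · -- cost ≤ K − 2
    rcases hdich with hlt | hgt
    · have A2 : (univ.filter fun l => d l < d calo).card + 1 ≤ (univ.filter fun l => (d l : ℚ) - u < (d cahi : ℚ) - w).card := rank_succ_le_cross d hdinj u w hlt
      omega
    · have B2 : (univ.filter fun l => d l < d cahi).card + 1 ≤ (univ.filter fun l => (d l : ℚ) - w < (d calo : ℚ) - u).card := rank_succ_le_cross d hdinj w u hgt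
      omega
  · -- pre-sum ≤ 2K − 4
    rcases hdich with hlt | hgt
    · have A2 : (univ.filter fun l => d l < d calo).card + 1 ≤ (univ.filter fun l => (d l : ℚ) - u < (d cahi : ℚ) - w).card := rank_succ_le_cross d hdinj u w hlt
      omega
    · have B2 : (univ.filter fun l => d l < d cahi).card + 1 ≤ (univ.filter fun l => (d l : ℚ) - w < (d calo : ℚ) - u).card := rank_succ_le_cross d hdinj w u hgt
      omega


end TwoRows

end SingleGauge

end Summit.ValiantsHypothesis.ValiantsHypothesis.Theorems.KPlusLogSqLaw
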